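import Literature.Computability.Complexity.FoldBricks
import Literature.Computability.Complexity.ListFoldBricks
import Literature.Computability.Complexity.IntPairBricks
import Literature.Computability.Complexity.PlumbingBricks
import Literature.Computability.Complexity.UnaryOffsets
import Literature.Computability.Complexity.StringCopy
import Literature.Computability.Complexity.LengthCompare
import Literature.Computability.Complexity.ProbabilisticClassesProofs
import HarnessLib

/-!
# Coin blocks: "some block of the coin string is accepted" is in `P`; all blocks fail rarely

Toolkit for repetition arguments with independent coin blocks (Arora–Barak 2009, §7.4.1: "run the
machine `k` times using independent coins each time"; Gill 1977, proof of Prop. 5.2(iii)), in the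
tree's normal form of probabilistic classes (a witness language `L' ∈ P` read on `boolPair x y`,
`ProbabilisticClasses.lean`) and its `FP` string algebra (`BrickAlgebra.lean`, `FoldBricks.lean`):
the coin string `r ∈ {0,1}^{K ℓ}` is cut into the blocks `r[jℓ, (j+1)ℓ)`, `j < K` — the tree's
`HashBricks.blk r ℓ j` (`HashBricks.lean`, in the import closure; the same function is
`block`/`length_block` of `ArthurMerlinParallelPlay.lean` and `YaoAmplification.blk`, not imported),
for which this file supplies the small API `blk_zero`/`blk_succ`/`length_blk` — and

* `CoinBlocks.blockOr A ℓ K = {⟨x, r⟩ | ∃ j < K(|x|), ⟨x, block_j r⟩ ∈ A}` is in `P` for `A ∈ P`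
  (`CoinBlocks.blockOr_mem_P`): the counted fold (`Brick.foldLoop`) of the one-bit pieces
  `[⟨x, block_j r⟩ ∈ A]` (`CoinBlocks.pieceF`, blocks addressed by unary offsets `1^{jℓ}`,
  `UnaryOffsets.mulLenFn`, `Plumb.takeFn`/`dropFn`) with the disjunction `CoinBlocks.orF`
  (the instance `Brick.orFn (isTrue1Fn ∘ fstF) (isTrue1Fn ∘ sndF)` of the bricks of
  `ListFoldBricks.lean` / `IntPairBricks.lean`);
* `CoinBlocks.two_pow_mul_cnt_allBlocks_le` — **independent blocks all fail rarely**: if at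
  most half of the strings of length `ℓ` lie in `B` then
  `2^K · #{r ∈ {0,1}^{Kℓ} | ∀ j < K, block_j r ∈ B} ≤ 2^{Kℓ}` (product rule `cnt_take_drop` of
  `ProbabilisticClassesProofs.lean`, induction on `K`). This is the constant-`OK` corollary of the
  general product rule for block events `cnt_blocks` (`IsolationAdvice.lean`:
  `cnt (F·B) {y | ∀ i < F, (y ⇂ iB) ↾ B ∈ OK i} = ∏ᵢ cnt B (OK i)`), reproved here in three
  lines from `cnt_take_drop` because `IsolationAdvice.lean` imports the Stockmeyer /
  Valiant–Vazirani / counting developments; a librarian may consolidate both (with `blk`) into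
  `BlockTuples.lean` / `ProbabilisticClassesProofs.lean`.

First client: the Las Vegas machine of `ZPP ⊇ RP ∩ coRP` (`ZPPExpectedTime.lean`).

## References

* S. Arora, B. Barak, *Computational Complexity: A Modern Approach*, CUP 2009, §7.4.1 (error
  reduction by independent repetitions), §1.3 (polynomial time is closed under bounded loops).
  [AroraBarakCC2009]
* J. Gill, *Computational complexity of probabilistic Turing machines*, SIAM J. Comput. 6 (1977)
  675–695, §5. [Gill1977]
-/

noncomputable section

namespace Literature.Computability.Complexity

open _root_.Computability Polynomial Brick
open HashBricks (blk)

namespace CoinBlocks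

/-! ### Blocks of a coin string: API of `HashBricks.blk` -/

/-- Block `0` is the prefix of length `ℓ` (`blk r ℓ j = (r ⇂ jℓ) ↾ ℓ`, `HashBricks.lean`).
[folklore] -/
theorem blk_zero (ℓ : ℕ) (r : List Bool) : blk r ℓ 0 = r.take ℓ := by
  simp [blk]

/-- Block `j + 1` of `r` is block `j` of `r ⇂ ℓ`. [folklore] -/
theorem blk_succ (ℓ j : ℕ) (r : List Bool) : blk r ℓ (j + 1) = blk (r.drop ℓ) ℓ j := by
  simp only [blk, List.drop_drop]
  congr 2
  ring

/-- A block inside the string has full length (twin of `length_block`,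
`ArthurMerlinParallelPlay.lean`, for `blk`). [folklore] -/
theorem length_blk {ℓ j : ℕ} {r : List Bool} (h : (j + 1) * ℓ ≤ r.length) :
    (blk r ℓ j).length = ℓ := by
  simp only [blk, List.length_take, List.length_drop]
  have : ℓ ≤ r.length - j * ℓ := by
    rw [Nat.succ_mul] at h
    omega
  omega

/-! ### The disjunction of answer words -/

/-- `isTrue1Fn [c] = [c]` (`Brick.isTrue1Fn w = [w = [1]]`, `IntPairBricks.lean`). [folklore] -/
theorem isTrue1Fn_singleton (c : Bool) : isTrue1Fn [c] = [c] := by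
  cases c <;> simp

/-- **The disjunction of answer words**: `orF ⟨a, b⟩ = [a = [1] ∨ b = [1]]`, a one-bit function
on every input — the instance `Brick.orFn (isTrue1Fn ∘ fstF) (isTrue1Fn ∘ sndF)` of the
disjunction brick of `ListFoldBricks.lean` with the test `Brick.isTrue1Fn` of `IntPairBricks.lean`.
[folklore] -/
def orF : List Bool → List Bool :=
  orFn (isTrue1Fn ∘ fstF) (isTrue1Fn ∘ sndF)

/-- Value of `orF` on a pair whose first component is a bit. [folklore] -/
theorem orF_boolPair_singleton (c : Bool) (v : List Bool) :
    orF (boolPair [c] v) = [c || decide (v = [true])] := by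
  have hc : (isTrue1Fn ∘ fstF) (boolPair [c] v) = [c] := by
    simp only [Function.comp_apply, fstF_boolPair, isTrue1Fn_singleton]
  have hv : (isTrue1Fn ∘ sndF) (boolPair [c] v) = [decide (v = [true])] := by
    simp only [Function.comp_apply, sndF_boolPair, isTrue1Fn_apply]
  exact orFn_apply hc hv

/-- `orF` is one-bit on every input. [folklore] -/
theorem oneBit_orF : OneBit orF :=
  oneBit_orFn (oneBit_isTrue1Fn.comp fstF) (oneBit_isTrue1Fn.comp sndF)

/-- Growth of `orF` (it is one symbol long). [folklore] -/
theorem length_orF_le (w : List Bool) : (orF w).length ≤ (fstF w).length + (sndF w).length + 1 := by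
  rw [oneBit_orF.length_eq w]
  omega

/-- `orF ∈ FP`. [folklore] -/
theorem orF_mem_FP : orF ∈ FP :=
  orFn_mem_FP (comp_mem_FP isTrue1Fn_mem_FP fstF_mem_FP) (comp_mem_FP isTrue1Fn_mem_FP sndF_mem_FP)

/-- **The `orF`-fold of one-bit pieces is their disjunction**: from the accumulator `[b]`, after
`k` rounds from index `i`, the accumulator is one bit, true iff `b` or some folded piece is `[1]`.
[folklore] -/
theorem foldAcc_orF (f : List Bool → List Bool) (x : List Bool) (i : ℕ) :
    ∀ (k : ℕ) (b : Bool), ∃ c : Bool, foldAcc orF f x i k [b] = [c] ∧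
      (c = true ↔ b = true ∨ ∃ j, j < k ∧ f (boolPair x (ones (i + j))) = [true])
  | 0, b => ⟨b, rfl, by simp⟩
  | k + 1, b => by
    obtain ⟨c, hc, hiff⟩ := foldAcc_orF f x i k b
    refine ⟨c || decide (f (boolPair x (ones (i + k))) = [true]), ?_, ?_⟩
    · rw [foldAcc_succ', hc, orF_boolPair_singleton]
    · rw [Bool.or_eq_true, hiff, decide_eq_true_iff]
      constructor
      · rintro ((hb | ⟨j, hj, hP⟩) | hP)
        · exact Or.inl hb
        · exact Or.inr ⟨j, Nat.lt_succ_of_lt hj, hP⟩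
        · exact Or.inr ⟨k, Nat.lt_succ_self k, hP⟩
      · rintro (hb | ⟨j, hj, hP⟩)
        · exact Or.inl (Or.inl hb)
        · rcases Nat.lt_succ_iff_lt_or_eq.1 hj with h | rfl
          · exact Or.inl (Or.inr ⟨j, h, hP⟩)
          · exact Or.inr hP

/-! ### The piece function: is block `j` accepted? -/

/-- The unary block length `1^{ℓ(|x|)}` read off `z = ⟨⟨x, r⟩, 1ʲ⟩`. [folklore] -/
def lenF (ℓ : Polynomial ℕ) : List Bool → List Bool :=
  Plumb.polyFn ℓ ∘ fstF ∘ fstF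

/-- Block `j` of `r` read off `z = ⟨⟨x, r⟩, 1ʲ⟩`: drop `|1ʲ| · ℓ(|x|)` symbols (a unary product,
`UnaryOffsets.mulLenFn`), keep `ℓ(|x|)`. [cite: AroraBarakCC2009, §7.4.1] -/
def blockF (ℓ : Polynomial ℕ) : List Bool → List Bool :=
  Plumb.takeFn ∘ fanoutFn (lenF ℓ)
    (Plumb.dropFn ∘ fanoutFn (UnaryOffsets.mulLenFn ∘ fanoutFn sndF (lenF ℓ)) (sndF ∘ fstF))

/-- **The piece function** `pieceF A ℓ ⟨⟨x, r⟩, 1ʲ⟩ = [⟨x, block_j r⟩ ∈ A]`.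
[cite: AroraBarakCC2009, §7.4.1] -/
def pieceF (A : Language Bool) (ℓ : Polynomial ℕ) : List Bool → List Bool :=
  (fun v => encodeBool (A.boolIndicator v)) ∘ fanoutFn (fstF ∘ fstF) (blockF ℓ)

/-- Value of `lenF`. [folklore] -/
theorem lenF_apply (ℓ : Polynomial ℕ) (x r u : List Bool) :
    lenF ℓ (boolPair (boolPair x r) u) = ones (ℓ.eval x.length) := by
  simp [lenF]

/-- Value of `blockF`. [folklore] -/
theorem blockF_apply (ℓ : Polynomial ℕ) (x r : List Bool) (j : ℕ) :
    blockF ℓ (boolPair (boolPair x r) (ones j)) = blk r (ℓ.eval x.length) j := by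
  simp [blockF, lenF_apply, blk]

/-- **Value of the piece function.** [folklore] -/
theorem pieceF_apply (A : Language Bool) (ℓ : Polynomial ℕ) (x r : List Bool) (j : ℕ) :
    pieceF A ℓ (boolPair (boolPair x r) (ones j)) =
      [A.boolIndicator (boolPair x (blk r (ℓ.eval x.length) j))] := by
  simp only [pieceF, Function.comp_apply, fanoutFn_apply, fstF_boolPair, blockF_apply]
  rfl

/-- The piece is `[1]` iff the block is accepted. [folklore] -/
theorem pieceF_eq_true_iff (A : Language Bool) (ℓ : Polynomial ℕ) (x r : List Bool) (j : ℕ) :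
    pieceF A ℓ (boolPair (boolPair x r) (ones j)) = [true] ↔
      boolPair x (blk r (ℓ.eval x.length) j) ∈ A := by
  rw [pieceF_apply, List.cons.injEq, ← Set.mem_iff_boolIndicator]
  exact and_iff_left rfl

/-- The piece function is one symbol long on every input. [folklore] -/
theorem length_pieceF_le (A : Language Bool) (ℓ : Polynomial ℕ) (w : List Bool) :
    (pieceF A ℓ w).length ≤ 1 * ((fstF w).length + 1) := by
  simp only [pieceF, Function.comp_apply]
  show [A.boolIndicator _].length ≤ _
  rw [List.length_singleton]
  omega

/-- `lenF ℓ ∈ FP`. [folklore] -/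
theorem lenF_mem_FP (ℓ : Polynomial ℕ) : lenF ℓ ∈ FP :=
  comp_mem_FP (Plumb.polyFn_mem_FP ℓ) (comp_mem_FP fstF_mem_FP fstF_mem_FP)

/-- `blockF ℓ ∈ FP`. [folklore] -/
theorem blockF_mem_FP (ℓ : Polynomial ℕ) : blockF ℓ ∈ FP :=
  comp_mem_FP Plumb.takeFn_mem_FP (fanoutFn_mem_FP (lenF_mem_FP ℓ)
    (comp_mem_FP Plumb.dropFn_mem_FP (fanoutFn_mem_FP
      (comp_mem_FP UnaryOffsets.mulLenFn_mem_FP (fanoutFn_mem_FP sndF_mem_FP (lenF_mem_FP ℓ)))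
      (comp_mem_FP sndF_mem_FP fstF_mem_FP))))

/-- **The piece function is polynomial time** for `A ∈ P`. [cite: AroraBarakCC2009, §7.4.1] -/
theorem pieceF_mem_FP {A : Language Bool} (hA : A ∈ Classes.P) (ℓ : Polynomial ℕ) :
    pieceF A ℓ ∈ FP :=
  comp_mem_FP (indicatorFn_mem_FP hA) (fanoutFn_mem_FP (comp_mem_FP fstF_mem_FP fstF_mem_FP)
    (blockF_mem_FP ℓ))

/-! ### The block disjunction -/

/-- The initial record `⟨⟨x, r⟩, ⟨bin K(|x|), ⟨1⁰, [0]⟩⟩⟩` of the fold loop. [folklore] -/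
def initF (K : Polynomial ℕ) : List Bool → List Bool :=
  fanoutFn id (fanoutFn (lenBinF ∘ Plumb.polyFn K ∘ fstF) fun _ => boolPair [] [false])

/-- Value of `initF` on a pair. [folklore] -/
theorem initF_boolPair (K : Polynomial ℕ) (x r : List Bool) :
    initF K (boolPair x r) =
      boolPair (boolPair x r) (boolPair (encodeNat (K.eval x.length)) (boolPair (ones 0) [false])) := by
  simp [initF]

/-- `initF K ∈ FP`. [folklore] -/
theorem initF_mem_FP (K : Polynomial ℕ) : initF K ∈ FP :=
  fanoutFn_mem_FP (PolyTimeComputable.id _) (fanoutFn_mem_FP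
    (comp_mem_FP lenBinF_mem_FP (comp_mem_FP (Plumb.polyFn_mem_FP K) fstF_mem_FP)) (const_mem_FP _))

/-- **The block disjunction as a string function**: `K(|⟨x,r⟩|)` rounds available (enough, as
`K(|x|) ≤ K(|⟨x, r⟩|)`), the answer being the accumulator of the fold.
[cite: AroraBarakCC2009, §7.4.1 and §1.3 (bounded loops)] -/
def blockOrFn (A : Language Bool) (ℓ K : Polynomial ℕ) : List Bool → List Bool :=
  sndPow 2 ∘ foldLoop orF (pieceF A ℓ) K ∘ initF K

/-- **`blockOrFn A ℓ K ∈ FP`** for `A ∈ P`. [cite: AroraBarakCC2009, §7.4.1 and §1.3] -/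
theorem blockOrFn_mem_FP {A : Language Bool} (hA : A ∈ Classes.P) (ℓ K : Polynomial ℕ) :
    blockOrFn A ℓ K ∈ FP :=
  comp_mem_FP (sndPow_mem_FP 2) (comp_mem_FP
    (foldLoop_mem_FP orF_mem_FP length_orF_le (pieceF_mem_FP hA ℓ) (length_pieceF_le A ℓ) K)
    (initF_mem_FP K))

/-- **Value of the block disjunction**: on `⟨x, r⟩` the answer is one bit, true iff some block
`j < K(|x|)` has `⟨x, block_j r⟩ ∈ A`. [cite: AroraBarakCC2009, §7.4.1] -/
theorem blockOrFn_boolPair (A : Language Bool) (ℓ K : Polynomial ℕ) (x r : List Bool) :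
    ∃ c : Bool, blockOrFn A ℓ K (boolPair x r) = [c] ∧
      (c = true ↔ ∃ j, j < K.eval x.length ∧ boolPair x (blk r (ℓ.eval x.length) j) ∈ A) := by
  obtain ⟨c, hc, hiff⟩ := foldAcc_orF (pieceF A ℓ) (boolPair x r) 0 (K.eval x.length) false
  refine ⟨c, ?_, ?_⟩
  · have hk : K.eval x.length ≤ K.eval (boolPair x r).length :=
      TM2Iter.eval_mono K (by rw [length_boolPair]; omega)
    simp only [blockOrFn, Function.comp_apply, initF_boolPair]
    rw [foldLoop_apply orF (pieceF A ℓ) hk 0 [false], hc]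
    simp
  · rw [hiff]
    simp only [Bool.false_eq_true, false_or, Nat.zero_add, pieceF_eq_true_iff]

/-- **The block disjunction language** `{w | ∃ j < K(|x|), ⟨x, block_j r⟩ ∈ A}` for
`(x, r) = boolUnpair w`. [cite: AroraBarakCC2009, §7.4.1] -/
def blockOr (A : Language Bool) (ℓ K : Polynomial ℕ) : Language Bool :=
  {w | ∃ j, j < K.eval (boolUnpair w).1.length ∧
    boolPair (boolUnpair w).1 (blk (boolUnpair w).2 (ℓ.eval (boolUnpair w).1.length) j) ∈ A}

/-- Membership in a set-builder `Language` (the `Language` membership instance is not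
syntactically that of `Set`, so `Set.mem_setOf_eq` does not rewrite). [folklore] -/
theorem mem_setOf_language {p : List Bool → Prop} {w : List Bool} :
    @Membership.mem (List Bool) (Language Bool) _ (setOf p) w ↔ p w :=
  Iff.rfl

/-- Membership of a pair in the block disjunction language. [folklore] -/
theorem boolPair_mem_blockOr {A : Language Bool} {ℓ K : Polynomial ℕ} {x r : List Bool} :
    boolPair x r ∈ blockOr A ℓ K ↔
      ∃ j, j < K.eval x.length ∧ boolPair x (blk r (ℓ.eval x.length) j) ∈ A := by
  rw [blockOr, mem_setOf_language, boolUnpair_boolPair]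

/-- **The block disjunction language is in `P`** for `A ∈ P`: its indicator is
`blockOrFn A ℓ K` behind the re-pairing normaliser `rePair` (malformed strings).
[cite: AroraBarakCC2009, §7.4.1 and §1.3 (bounded loops)] -/
theorem blockOr_mem_P {A : Language Bool} (hA : A ∈ Classes.P) (ℓ K : Polynomial ℕ) :
    blockOr A ℓ K ∈ Classes.P := by
  refine mem_P_of_mem_FP (comp_mem_FP (blockOrFn_mem_FP hA ℓ K) rePair_mem_FP) _ fun w => ?_
  obtain ⟨c, hc, hiff⟩ := blockOrFn_boolPair A ℓ K (boolUnpair w).1 (boolUnpair w).2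
  have hval : (blockOrFn A ℓ K ∘ rePair) w = [c] := hc
  have hmem : w ∈ blockOr A ℓ K ↔ c = true := by
    rw [hiff]
    rfl
  refine ⟨fun hw => ?_, fun hw => ?_⟩
  · rw [hval, (hmem.1 hw)]
  · rw [hval]
    cases c
    · rfl
    · exact absurd (hmem.2 rfl) hw

/-! ### Independent blocks all fail rarely -/

/-- The event "all `K` blocks of length `ℓ` lie in `B`" — the set of `cnt_blocks`
(`IsolationAdvice.lean`) with the constant family `OK i = B`. [cite: AroraBarakCC2009, §7.4.1] -/
def allBlocks (ℓ K : ℕ) (B : Set (List Bool)) : Set (List Bool) :=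
  {r | ∀ j, j < K → blk r ℓ j ∈ B}

/-- One more block: the first block is in `B` and the rest has all its `K` blocks in `B`.
[folklore] -/
theorem mem_allBlocks_succ (ℓ K : ℕ) (B : Set (List Bool)) (r : List Bool) :
    r ∈ allBlocks ℓ (K + 1) B ↔ r.take ℓ ∈ B ∧ r.drop ℓ ∈ allBlocks ℓ K B := by
  simp only [allBlocks, Set.mem_setOf_eq]
  constructor
  · intro h
    refine ⟨by simpa [blk_zero] using h 0 (Nat.succ_pos K), fun j hj => ?_⟩
    rw [← blk_succ]
    exact h (j + 1) (by omega)
  · rintro ⟨h0, hrest⟩ j hj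
    cases j with
    | zero => simpa [blk_zero] using h0
    | succ j =>
      rw [blk_succ]
      exact hrest j (by omega)

/-- **Independent blocks all fail rarely** (Arora–Barak 2009, §7.4.1; Gill 1977, proof of
Prop. 5.2): if at most half of the strings of length `ℓ` lie in `B`, then at most a `2^{-K}`
fraction of the strings of length `K ℓ` have all their `K` blocks in `B`:
`2^K · cnt (Kℓ) (allBlocks ℓ K B) ≤ 2^{Kℓ}` (product rule `cnt_take_drop`, induction on `K`;
the constant-`OK` corollary of `cnt_blocks`, `IsolationAdvice.lean`, which is not imported —
see the file header). [cite: AroraBarakCC2009, §7.4.1] -/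
theorem two_pow_mul_cnt_allBlocks_le (ℓ : ℕ) {B : Set (List Bool)} (hB : 2 * cnt ℓ B ≤ 2 ^ ℓ) :
    ∀ K : ℕ, 2 ^ K * cnt (K * ℓ) (allBlocks ℓ K B) ≤ 2 ^ (K * ℓ)
  | 0 => by
    simp only [pow_zero, one_mul, Nat.zero_mul]
    exact cnt_le 0 _
  | K + 1 => by
    have ih := two_pow_mul_cnt_allBlocks_le ℓ hB K
    have hlen : (K + 1) * ℓ = ℓ + K * ℓ := by ring
    have hprod : cnt ((K + 1) * ℓ) (allBlocks ℓ (K + 1) B) = cnt ℓ B * cnt (K * ℓ) (allBlocks ℓ K B) := by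
      rw [hlen, ← cnt_take_drop ℓ (K * ℓ) B (allBlocks ℓ K B)]
      exact cnt_congr fun y _ => mem_allBlocks_succ ℓ K B y
    rw [hprod, pow_succ, hlen, pow_add]
    calc 2 ^ K * 2 * (cnt ℓ B * cnt (K * ℓ) (allBlocks ℓ K B))
        = (2 * cnt ℓ B) * (2 ^ K * cnt (K * ℓ) (allBlocks ℓ K B)) := by ring
      _ ≤ 2 ^ ℓ * 2 ^ (K * ℓ) := Nat.mul_le_mul hB ih

end CoinBlocks

end Literature.Computability.Complexity
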